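import Summits.BirchSwinnertonDyer.BirchSwinnertonDyer.Theorems.EdixhovenFibreFiveSevenStarredOptimalManinUnitFiveSevenRecTowerCellsOfLocalFormulaAlt
import Summits.BirchSwinnertonDyer.BirchSwinnertonDyer.Theorems.EdixhovenFibreFiveSevenRecTowerAtCyclotomicOverCompletionOfIsDeRham
import Summits.BirchSwinnertonDyer.BirchSwinnertonDyer.Theorems.EdixhovenFibreFiveSevenLocalFormulaUnstarredSupersingularCells
import HarnessLib

/-!
# [REC-tower] PROVED at every cyclotomic tower `ℚ_v ⊆ ℚ(ζ_m)_w` for the curves of the UNSTARRED potentially SUPERSINGULAR cells `(5; II)`, `(5; IV)`, `(7; III)`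
# (route `EdixhovenFibreFiveSeven`, line `kato-lever`; seat `bsd-line-edix-p1` g33, LEAD)

HONEST FRAMING. ONE theorem (no definition, no named fact, no instance, no `sorry`; file-local instance keys on `ℚ_v` byte-identical to
`…RecTowerCellsOfLocalFormulaAlt` l.56–61); helper `--supports` LOW (`SupersingularTorsionOptimalManinUnitFive`, stmt-BirchSwinnertonDyer-23884, cell `(5; II)`)
and, through the same cells, TDS57 (stmt-BirchSwinnertonDyer-22227) / KP57 (stmt-BirchSwinnertonDyer-23810). Nothing is closed; BSD / LOW / TDS57 are NOT proved by this.

WHAT. Kato's explicit reciprocity law [REC-tower] (`tatePairingPoint_eq_trace_expStar_log_tower`, LNM 1553 II Thm. 1.4.1 (4) — cite-only in the tree) in the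
INTRINSIC, ALTERNATING-TOWER shape of the K★ stubs (`…CellsOfRecTowerAtIntrinsicAlt`: `∃ c ≠ 0`, lower clause at `ℚ_v`, upper clause at `ℚ(ζ_m)_w`), for every
globally minimal `W′/ℚ` with `p ∈ {5, 7}`, additive reduction at `p`, `E[p]` irreducible, no `Iₙ*` fibre at `p`, `ord_p Δ_min ≤ 4`, IN one of the three unstarred
potentially supersingular cells `(5; ord = 2)`, `(5; ord = 4)`, `(7; ord = 3)` (Kodaira II, IV at `5`, III at `7`), at every cyclotomic tower `ℚ_v ⊆ ℚ(ζ_m)_w`,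
`p ∤ m` — a THEOREM, no hypothesis left: the width seat's turnkey on all twelve cells
(`RecTowerAtCyclotomicOverCompletionOfIsDeRham.recTowerAt_cyclotomic_potGoodFiveSeven_of_formula_over_completion`, edix-p4 g31: de Rham input
`isDeRham_place_of_potGoodFiveSeven`, adelic base-change packet) fed with Kato's LOCAL FORMULA over `K_{w′}`, `K = ℚ(ζ_m, p^{1/e})`
(`StarredOptimalManinUnitFiveSevenRecTowerKData.exists_numberField_over_cyclotomic_pow_eq_prime`), PROVED at these cells by
`LocalFormulaUnstarredSupersingularCells.localFormulaUnstarredSupersingularCells` (this seat, p802622 — the inequality-free supersingular numerology via the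
tower-descent (N1‴) `AinfRamTop.omegaPeriod_ne_zero_of_varpi_shape_tower`, p802470; the cell `(5; II)` = `(5; e = 6, r₄ = 2)` was out of reach of (N1′)).
The Prop-1.2.3 binders over `K_{w′}` come from de Rham ascent `ℚ_v → ℚ(ζ_m)_w → K_{w′}` (`isDeRham_restrictedRationalTateRep_of_tower`) and
`cupLogInjective_and_hasDualExp_of_isDeRham_holds`. Verbatim the proof of `recTowerSupersingularCells_of_localFormulaAlt` (g30) with the starred cell data
replaced by the unstarred ones.

* ★★★ `recTowerUnstarredSupersingularCells`.

Companion (width seat edix-p4 g31): the three unstarred ORDINARY cells `(5; III)`, `(7; II)`, `(7; IV)`. With both, [REC-tower] is a tree theorem at every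
potentially good additive cell at `p ∈ {5, 7}` (the six starred cells: `…RecTowerCellsOfLocalFormulaAlt` + the K★ stubs), and the Manin binders of the
rung W-ALL/2.p≥5.r1 rest on {modularity, P1-bar} alone (assembly: next files).

References: [Kato1993LNM1553] Ch. II §1.2.4, Prop. 1.2.3, Ex. 1.3.5, Thm. 1.4.1 (3)–(4); [BrinonConrad2009] Prop. 6.3.8; [CasselsFrohlichANT1967] Ch. II §10 (10.2);
[Fontaine1982FormesDifferentielles] §5; [Serre1967GroupesPDivisibles] §5 Lemme 3; [SilvermanATAEC1994] IV Table 4.1.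
-/

set_option autoImplicit false
-- the Theorems namespace of a single-conjunct summit repeats the summit name by design (D-0017)
set_option linter.dupNamespace false

noncomputable section

open scoped Classical NNReal TensorProduct NumberField
open CategoryTheory Function Field ValuativeRel IsDedekindDomain NumberField
open Literature.NumberTheory.GaloisRepresentations
open Literature.NumberTheory.GaloisRepresentations.IsNonarchimedeanLocalField
open Literature.NumberTheory.GaloisRepresentations.PeriodRingData
open Literature.NumberTheory.PAdicHodge
open Literature.NumberTheory.EllipticCurves _root_.WeierstrassCurve
open Literature.NumberTheory.EllipticCurves.FormalGroupChart (padicLogPointFiniteExt)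
open Summit.BirchSwinnertonDyer.BirchSwinnertonDyer.Theorems.StarredOptimalManinUnitFiveSevenRecTowerAtCyclotomicOverExt
open Summit.BirchSwinnertonDyer.BirchSwinnertonDyer.Theorems.RecTowerAtCyclotomicOverCompletionOfIsDeRham
open Summit.BirchSwinnertonDyer.BirchSwinnertonDyer.Theorems.StarredOptimalManinUnitFiveSevenRecTowerCellsOfLocalFormula (compatible_normValuation_adicCompletion)
open Summit.BirchSwinnertonDyer.BirchSwinnertonDyer.Theorems.LocalFormulaUnstarredSupersingularCells
open Summit.BirchSwinnertonDyer.BirchSwinnertonDyer.Theorems.KimAtThreeDeepLowerExpStarOmega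
open Summit.BirchSwinnertonDyer.BirchSwinnertonDyer.Theorems.KimAtThreeDeepLowerExpStarOmegaPlace
open Summit.BirchSwinnertonDyer.BirchSwinnertonDyer.Theorems.KimAtThreeDeepUpperTowerLattice (fact_natCast_mem_primesEquiv_symm)
open Summit.BirchSwinnertonDyer.Rank1Residual.GaloisImage
open Rat.HeightOneSpectrum Literature.NumberTheory.DiophantineGeometry
open Summit.BirchSwinnertonDyer.Rank1Residual Summit.BirchSwinnertonDyer.Rank1Residual.Additive
  Literature.NumberTheory.EllipticCurves.Rank1Residual
open Literature.NumberTheory.AdelicBaseChange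
open Summit.BirchSwinnertonDyer.BirchSwinnertonDyer.Theorems

namespace Summit.BirchSwinnertonDyer.BirchSwinnertonDyer.Theorems.RecTowerUnstarredSupersingularCells

-- FILE-LOCAL instance keys, byte-identical to the accepted `…RecTowerCellsOfLocalFormulaAlt.lean` l.56–61 (no library instance is
-- overridden outside this file): the `Fact (p ∈ v_p)` key and the local-field structures on `ℚ_v = Place.Completion (inr v_p)`.
attribute [local instance] fact_natCast_mem_primesEquiv_symm
attribute [local instance 100000] NumberField.Place.instAlgebraCompletion
attribute [local instance] valuativeRelPlace topologicalSpacePlace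
attribute [local instance] isNonarchimedeanLocalField_place charZero_place
attribute [local instance] padicAlgebraPlace fact_not_isUnit_place isAdicComplete_place

/-- ★★★ **[REC-tower] at every cyclotomic tower for the curves of the unstarred potentially SUPERSINGULAR cells — PROVED.** For every globally minimal
`W′/ℚ` with `p ∈ {5, 7}`, additive reduction at `p`, `E[p]` irreducible, no `Iₙ*` fibre at `p`, `ord_p Δ_min ≤ 4`, in a cell `(5; ord_5 Δ_min = 2)`,
`(5; ord_5 Δ_min = 4)` or `(7; ord_7 Δ_min = 3)` (Kodaira II, IV at `5`; III at `7`), every `m` with `p ∤ m`, every place `w ∣ p` of `ℚ(ζ_m)` (keys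
quantified), every pair of compatible valuations, every ALTERNATING Weil tower, line data `d₀` at `ℚ_v` and `d` at `ℚ(ζ_m)_w` with the compatibility
`hcomp`, and the Prop-1.2.3 binders: **`∃ c ≠ 0` with `⟨[η₀], P⟩ = Tr(c·exp*_{d₀}(η₀)·log P)` at `ℚ_v` and `⟨[η], P⟩ = Tr(c·exp*_d(η)·log P)` at `ℚ(ζ_m)_w`.**
Proof: the twelve-cell turnkey `recTowerAt_cyclotomic_potGoodFiveSeven_of_formula_over_completion` over `K = ℚ(ζ_m, p^{1/e})` at a place `w′ ∣ w`, fed with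
Kato's local formula `localFormulaUnstarredSupersingularCells` (tower-descent numerology, no ramification inequality) and the de Rham ascent for the
Prop-1.2.3 binders. [cite: Kato1993LNM1553, Ch. II §1.2.4, Prop. 1.2.3 and Thm. 1.4.1 (3)–(4)] [cite: BrinonConrad2009, Prop. 6.3.8]
[cite: Serre1967GroupesPDivisibles, §5 Lemme 3] [cite: SilvermanATAEC1994, IV Table 4.1] -/
theorem recTowerUnstarredSupersingularCells :
    ∀ (W' : WeierstrassCurve ℚ) [W'.IsElliptic] [W'.IsGloballyMinimal] (p : ℕ) [hp : Fact p.Prime], (p = 5 ∨ p = 7) → Addv W' p → Irr W' p →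
      (∀ (v : HeightOneSpectrum ℤ) (n : ℕ), natGenerator v = p → W'.kodairaSymbolAt v ≠ KodairaSymbol.Istar n) →
      padicValInt p W'.minimalDiscriminantInt ≤ 4 →
      (p = 5 ∧ padicValInt p W'.minimalDiscriminantInt = 2 ∨ p = 5 ∧ padicValInt p W'.minimalDiscriminantInt = 4 ∨
        p = 7 ∧ padicValInt p W'.minimalDiscriminantInt = 3) → ∀ (m : ℕ) [NeZero m], ¬ p ∣ m →
      ∀ (w : ((primesEquiv (R := 𝓞 ℚ)).symm ⟨p, hp.out⟩).Extension (𝓞 (CyclotomicField m ℚ))) (hw : ((p : ℕ) : 𝓞 (CyclotomicField m ℚ)) ∈ w.1.asIdeal)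
      [CharZero (w.1.adicCompletion (CyclotomicField m ℚ))] [Fact (¬ IsUnit ((p : ℕ) : integerC (w.1.adicCompletion (CyclotomicField m ℚ))))]
      [IsAdicComplete (Ideal.span {((p : ℕ) : integerC (w.1.adicCompletion (CyclotomicField m ℚ)))}) (integerC (w.1.adicCompletion (CyclotomicField m ℚ)))]
      (hL : valuation (w.1.adicCompletion (CyclotomicField m ℚ)) ((p : ℕ) : (w.1.adicCompletion (CyclotomicField m ℚ))) < 1), letI := LocalField.adicCompletionPadicAlgebra w.1 p hw
      letI : Algebra (Place.Completion (K := ℚ) (Sum.inr ((primesEquiv (R := 𝓞 ℚ)).symm ⟨p, hp.out⟩))) (w.1.adicCompletion (CyclotomicField m ℚ)) :=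
      inferInstanceAs (Algebra (((primesEquiv (R := 𝓞 ℚ)).symm ⟨p, hp.out⟩).adicCompletion ℚ) (w.1.adicCompletion (CyclotomicField m ℚ)))
      ∀ (wv : Valuation (Place.Completion (Sum.inr ((primesEquiv (R := 𝓞 ℚ)).symm ⟨p, hp.out⟩) : Place ℚ)) ℝ≥0) [wv.Compatible]
      [(W'.baseChange (Place.Completion (Sum.inr ((primesEquiv (R := 𝓞 ℚ)).symm ⟨p, hp.out⟩) : Place ℚ))).IsIntegral wv.integer]
      (ν : Valuation (w.1.adicCompletion (CyclotomicField m ℚ)) ℝ≥0) [ν.Compatible] [(W'.baseChange (w.1.adicCompletion (CyclotomicField m ℚ))).IsIntegral ν.integer]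
      (e : (k : ℕ) → geomTorsion W' ((p ^ k : ℕ) : ℤ) → geomTorsion W' ((p ^ k : ℕ) : ℤ) → AlgebraicClosure ℚ) (hμ : ∀ k S T, e k S T ^ (p ^ k) = 1)
      (hadd₁ : ∀ k S₁ S₂ T, e k (S₁ + S₂) T = e k S₁ T * e k S₂ T) (hadd₂ : ∀ k S T₁ T₂, e k S (T₁ + T₂) = e k S T₁ * e k S T₂)
      (hgal : ∀ k (σ : absoluteGaloisGroup ℚ) (S T : geomTorsion W' ((p ^ k : ℕ) : ℤ)), σ • e k S T = e k (σ • S) (σ • T))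
      (_hnondeg : ∀ k (T : geomTorsion W' ((p ^ k : ℕ) : ℤ)), (∀ S, e k S T = 1) → T = 0) (_halt : ∀ k (S : geomTorsion W' ((p ^ k : ℕ) : ℤ)), e k S S = 1)
      (hcompat : ∀ k (S T : geomTorsion W' ((p ^ (k + 1) : ℕ) : ℤ)),
      e k (torsionMulHom W' (p ^ (k + 1)) (p ^ k) p (pow_succ p k).symm S) (torsionMulHom W' (p ^ (k + 1)) (p ^ k) p (pow_succ p k).symm T) = e (k + 1) S T ^ p)
      (d₀ : LocalNeronLineAt W' p ((primesEquiv (R := 𝓞 ℚ)).symm ⟨p, hp.out⟩)) (d : LocalNeronLine W' hL ((galRestrictPlace ((primesEquiv (R := 𝓞 ℚ)).symm ⟨p, hp.out⟩)).comp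
      (absGaloisRestrict (Place.Completion (Sum.inr ((primesEquiv (R := 𝓞 ℚ)).symm ⟨p, hp.out⟩) : Place ℚ)) (w.1.adicCompletion (CyclotomicField m ℚ))))),
      (bdRPeriodRingData (valuation_place_lt_one p ((primesEquiv (R := 𝓞 ℚ)).symm ⟨p, hp.out⟩))).CupLogInjective (logCyclotomic p)
      (localRationalTateRep W' p (galRestrictPlace ((primesEquiv (R := 𝓞 ℚ)).symm ⟨p, hp.out⟩))) →
      (∀ z : contOneCocycles (localRationalTateRep W' p (galRestrictPlace ((primesEquiv (R := 𝓞 ℚ)).symm ⟨p, hp.out⟩))).toTopRep,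
      (bdRPeriodRingData (valuation_place_lt_one p ((primesEquiv (R := 𝓞 ℚ)).symm ⟨p, hp.out⟩))).HasDualExp (logCyclotomic p)
      (localRationalTateRep W' p (galRestrictPlace ((primesEquiv (R := 𝓞 ℚ)).symm ⟨p, hp.out⟩))) fun σ => z.1 σ) →
      (bdRPeriodRingData (F := (w.1.adicCompletion (CyclotomicField m ℚ))) (p := p) hL).CupLogInjective (logCyclotomic p) (localRationalTateRep W' p
      ((galRestrictPlace ((primesEquiv (R := 𝓞 ℚ)).symm ⟨p, hp.out⟩)).comp (absGaloisRestrict (Place.Completion (Sum.inr ((primesEquiv (R := 𝓞 ℚ)).symm ⟨p, hp.out⟩) : Place ℚ)) (w.1.adicCompletion (CyclotomicField m ℚ))))) →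
      (∀ z : contOneCocycles (localRationalTateRep W' p
      ((galRestrictPlace ((primesEquiv (R := 𝓞 ℚ)).symm ⟨p, hp.out⟩)).comp (absGaloisRestrict (Place.Completion (Sum.inr ((primesEquiv (R := 𝓞 ℚ)).symm ⟨p, hp.out⟩) : Place ℚ)) (w.1.adicCompletion (CyclotomicField m ℚ))))).toTopRep,
      (bdRPeriodRingData (F := (w.1.adicCompletion (CyclotomicField m ℚ))) (p := p) hL).HasDualExp (logCyclotomic p) (localRationalTateRep W' p
      ((galRestrictPlace ((primesEquiv (R := 𝓞 ℚ)).symm ⟨p, hp.out⟩)).comp (absGaloisRestrict (Place.Completion (Sum.inr ((primesEquiv (R := 𝓞 ℚ)).symm ⟨p, hp.out⟩) : Place ℚ)) (w.1.adicCompletion (CyclotomicField m ℚ)))))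
      fun σ => z.1 σ) → (∀ (η₀ : contOneCocycles (restrictedTateRep W' (Place.Completion (Sum.inr ((primesEquiv (R := 𝓞 ℚ)).symm ⟨p, hp.out⟩) : Place ℚ)) p).toTopRep)
      (ηT : contOneCocycles ((restrictedTateRep W' (Place.Completion (Sum.inr ((primesEquiv (R := 𝓞 ℚ)).symm ⟨p, hp.out⟩) : Place ℚ)) p).restrict
      (absGaloisRestrict (Place.Completion (Sum.inr ((primesEquiv (R := 𝓞 ℚ)).symm ⟨p, hp.out⟩) : Place ℚ)) (w.1.adicCompletion (CyclotomicField m ℚ)))).toTopRep),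
      (∀ σ, ηT.1 σ = η₀.1 (absGaloisRestrict (Place.Completion (Sum.inr ((primesEquiv (R := 𝓞 ℚ)).symm ⟨p, hp.out⟩) : Place ℚ)) (w.1.adicCompletion (CyclotomicField m ℚ)) σ)) →
      expStarCoordTower W' (F₀ := (Place.Completion (Sum.inr ((primesEquiv (R := 𝓞 ℚ)).symm ⟨p, hp.out⟩) : Place ℚ))) hL d ηT =
      algebraMap (Place.Completion (Sum.inr ((primesEquiv (R := 𝓞 ℚ)).symm ⟨p, hp.out⟩) : Place ℚ)) (w.1.adicCompletion (CyclotomicField m ℚ))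
      (expStarCoord W' (valuation_place_lt_one p ((primesEquiv (R := 𝓞 ℚ)).symm ⟨p, hp.out⟩)) d₀ η₀)) →
      ∃ c : (Place.Completion (Sum.inr ((primesEquiv (R := 𝓞 ℚ)).symm ⟨p, hp.out⟩) : Place ℚ)), c ≠ 0 ∧
      (∀ (η₀ : contOneCocycles (restrictedTateRep W' (Place.Completion (Sum.inr ((primesEquiv (R := 𝓞 ℚ)).symm ⟨p, hp.out⟩) : Place ℚ)) p).toTopRep)
      (P : (W'.baseChange (Place.Completion (Sum.inr ((primesEquiv (R := 𝓞 ℚ)).symm ⟨p, hp.out⟩) : Place ℚ))).toAffine.Point),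
      ((tatePairingPoint W' (Place.Completion (Sum.inr ((primesEquiv (R := 𝓞 ℚ)).symm ⟨p, hp.out⟩) : Place ℚ)) p e hμ hadd₁ hadd₂ hgal hcompat (oneCocycleClass _ η₀) P : ℤ_[p]) : ℚ_[p]) =
      Algebra.trace ℚ_[p] (Place.Completion (Sum.inr ((primesEquiv (R := 𝓞 ℚ)).symm ⟨p, hp.out⟩) : Place ℚ))
      (c * expStarCoord W' (valuation_place_lt_one p ((primesEquiv (R := 𝓞 ℚ)).symm ⟨p, hp.out⟩)) d₀ η₀ *
      padicLogPointFiniteExt wv (W'.baseChange (Place.Completion (Sum.inr ((primesEquiv (R := 𝓞 ℚ)).symm ⟨p, hp.out⟩) : Place ℚ))) p P)) ∧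
      (∀ (ηT : contOneCocycles ((restrictedTateRep W' (Place.Completion (Sum.inr ((primesEquiv (R := 𝓞 ℚ)).symm ⟨p, hp.out⟩) : Place ℚ)) p).restrict
      (absGaloisRestrict (Place.Completion (Sum.inr ((primesEquiv (R := 𝓞 ℚ)).symm ⟨p, hp.out⟩) : Place ℚ)) (w.1.adicCompletion (CyclotomicField m ℚ)))).toTopRep)
      (P : (W'.baseChange (w.1.adicCompletion (CyclotomicField m ℚ))).toAffine.Point),
      ((tatePairingPointTower W' (Place.Completion (Sum.inr ((primesEquiv (R := 𝓞 ℚ)).symm ⟨p, hp.out⟩) : Place ℚ)) e hμ hadd₁ hadd₂ hgal hcompat (oneCocycleClass _ ηT) P : ℤ_[p]) : ℚ_[p]) =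
      Algebra.trace ℚ_[p] (w.1.adicCompletion (CyclotomicField m ℚ))
      (algebraMap (Place.Completion (Sum.inr ((primesEquiv (R := 𝓞 ℚ)).symm ⟨p, hp.out⟩) : Place ℚ)) (w.1.adicCompletion (CyclotomicField m ℚ)) c * expStarCoordTower W' (F₀ := (Place.Completion (Sum.inr ((primesEquiv (R := 𝓞 ℚ)).symm ⟨p, hp.out⟩) : Place ℚ))) hL d ηT *
      padicLogPointFiniteExt ν (W'.baseChange (w.1.adicCompletion (CyclotomicField m ℚ))) p P)) := by
  intro W' _ _ p hp hp57 hadd hirr hIstar h4 htab0 m _ _hm w hw _ _ _ hL wv _ _ ν _ _ e hμ hadd₁ hadd₂ hgal hnondeg halt hcompat d₀ d _hcli₀ _hde₀ hcli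
    hde hcomp
  -- the cell's ramification index `e` (Tate's table: (5; II) ↦ 6, (5; IV) ↦ 3, (7; III) ↦ 4)
  obtain ⟨e', he', htab⟩ : ∃ e' : ℕ, 0 < e' ∧ (p = 5 ∧ padicValInt p W'.minimalDiscriminantInt = 2 ∧ e' = 6 ∨
      p = 5 ∧ padicValInt p W'.minimalDiscriminantInt = 4 ∧ e' = 3 ∨ p = 7 ∧ padicValInt p W'.minimalDiscriminantInt = 3 ∧ e' = 4) := by
    rcases htab0 with ⟨h5, h2⟩ | ⟨h5, h4'⟩ | ⟨h7, h3⟩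
    · exact ⟨6, by norm_num, Or.inl ⟨h5, h2, rfl⟩⟩
    · exact ⟨3, by norm_num, Or.inr (Or.inl ⟨h5, h4', rfl⟩)⟩
    · exact ⟨4, by norm_num, Or.inr (Or.inr ⟨h7, h3, rfl⟩)⟩
  -- K-DATA: `K = ℚ(ζ_m, p^{1/e})`, a place `w′ ∣ w`, the packet keys of `K_{w′}`, the compatible norm valuation
  obtain ⟨K, _, _, _, _, α, hα, hpl⟩ := StarredOptimalManinUnitFiveSevenRecTowerKData.exists_numberField_over_cyclotomic_pow_eq_prime m he' p
  obtain ⟨w', hw'⟩ := hpl w.1 hw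
  haveI : CharZero (w'.1.adicCompletion K) := LocalField.charZero_adicCompletion w'.1
  have hp' : valuation (w'.1.adicCompletion K) ((p : ℕ) : w'.1.adicCompletion K) < 1 := LocalField.valuation_adicCompletion_natCast_lt_one w'.1 p hw'
  haveI : Fact (¬ IsUnit ((p : ℕ) : integerC (w'.1.adicCompletion K))) := ⟨not_isUnit_natCast_integerC hp'⟩
  haveI : IsAdicComplete (Ideal.span {((p : ℕ) : integerC (w'.1.adicCompletion K))}) (integerC (w'.1.adicCompletion K)) :=
    isAdicComplete_integerC_natCast hp'
  haveI := compatible_normValuation_adicCompletion (K := K) w'.1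
  haveI : (W'.baseChange (w'.1.adicCompletion K)).IsIntegral (NormedField.valuation : Valuation (w'.1.adicCompletion K) ℝ≥0).integer :=
    KPort.Kw.isIntegral_baseChange_of_isGloballyMinimal _ W'
  letI := LocalField.adicCompletionPadicAlgebra w.1 p hw
  letI : Algebra (Place.Completion (K := ℚ) (Sum.inr ((primesEquiv (R := 𝓞 ℚ)).symm ⟨p, hp.out⟩))) (w.1.adicCompletion (CyclotomicField m ℚ)) :=
    inferInstanceAs (Algebra (((primesEquiv (R := 𝓞 ℚ)).symm ⟨p, hp.out⟩).adicCompletion ℚ) (w.1.adicCompletion (CyclotomicField m ℚ)))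
  letI := LocalField.adicCompletionPadicAlgebra w'.1 p hw'
  -- the Prop-1.2.3 binders of the direct representation over `K_{w′}`: de Rham ascent `ℚ_v → L_w → K_{w′}` + Kato II Prop. 1.2.3
  have hcont : Continuous (algebraMap (Place.Completion (Sum.inr ((primesEquiv (R := 𝓞 ℚ)).symm ⟨p, hp.out⟩) : Place ℚ)) (w.1.adicCompletion (CyclotomicField m ℚ))) := w.adicCompletionSemialgHom_continuous ℚ (CyclotomicField m ℚ)
  haveI : Module.Finite ℚ_[p] (W'.rationalTateModule p) := module_finite_rationalTateModule_holds W' p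
  have hDRK : GaloisRep.IsDeRham (bdRPeriodRingData (F := w'.1.adicCompletion K) (p := p) hp')
      (restrictedRationalTateRep W' (w'.1.adicCompletion K) p) :=
    isDeRham_restrictedRationalTateRep_of_tower W' (w'.adicCompletionSemialgHom_continuous (CyclotomicField m ℚ) K) hL hp'
      (isDeRham_restrictedRationalTateRep_of_tower W' hcont (valuation_place_lt_one p ((primesEquiv (R := 𝓞 ℚ)).symm ⟨p, hp.out⟩)) hL
        (isDeRham_place_of_potGoodFiveSeven W' p hp57 hadd hirr hIstar))
  obtain ⟨hinjK, hdeK⟩ := cupLogInjective_and_hasDualExp_of_isDeRham_holds hp' (restrictedRationalTateRep W' (w'.1.adicCompletion K) p) hDRK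
  exact recTowerAt_cyclotomic_potGoodFiveSeven_of_formula_over_completion W' p hp57 hadd hirr hIstar m w hw hL wv ν w' hw' hp'
    (NormedField.valuation : Valuation (w'.1.adicCompletion K) ℝ≥0) e hμ hadd₁ hadd₂ hgal hcompat hnondeg hcli hde d₀ d hcomp
    (localFormulaUnstarredSupersingularCells W' p hp57 hadd hirr hIstar h4 α e' htab hα w'.1 hw' hp' NormedField.valuation e hμ hadd₁ hadd₂ hgal
      hnondeg halt hcompat hinjK hdeK)

end Summit.BirchSwinnertonDyer.BirchSwinnertonDyer.Theorems.RecTowerUnstarredSupersingularCells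

end
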